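import Mathlib
import HarnessLib
import Summits.ABC.ABC.Statement
import Summits.ABC.ABC.Theorems.SoloBlindSquarePencilKnown
import Literature.NumberTheory.DiophantineApproximation.SPartPolynomialValuesProofs

/-!
# The square pencil `2^l + q = r²` is decided by Ridout's theorem (abc there, ineffectively)

Companion to `SoloBlindSquarePencilKnown.lean` (T52).  There the dictionary lemma
`squarePencil_abc_of_depth` reduced abc on the pencil `2^l + q = r²` (`q` odd; `q`, `r` squarefree)
to a DEPTH BOUND `c = r² ≪_δ q^{2+δ}` for every `δ > 0`.  Here that depth bound is DERIVED from the
`p`-adic Thue–Siegel–Roth theorem for rationals — Ridout 1958 [Ridout1958], in the form of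
Bombieri–Gubler, *Heights*, Thm. 6.2.3 for `K = ℚ`, `S ∋ ∞` [BombieriGubler2006] — taken as a
HYPOTHESIS in exactly the shape `hRat` already used in this library
(`Literature.NumberTheory.DiophantineApproximation.padicRoth_int_of_rat`), so that one proof of that
statement discharges both files.  Nothing here is effective: the constant `C` depends on the finite
exceptional set of Roth–Ridout.

## The argument (`l = 2j + 1` odd; even `l` is trivial since then `(r − 2^j)(r + 2^j) = q ≥ r`)

Put `β = 2^j / r ∈ ℚ` (lowest terms: `r` is odd), `α_∞ = 1/√2`, `α_2 = 0`, `S = {2}`.  Then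
* `H(β) = max(2^j, r) = r` (`r² = 2·4^j + q > 4^j`);
* archimedean: `|2^j/r − 1/√2| = (r − 2^j√2)/(r√2) = q / (r√2 (r + 2^j√2)) ≤ q / r²`
  (`squarePencil_archimedean`, from `(r − 2^j√2)(r + 2^j√2) = r² − 2·4^j = q`);
* `2`-adic: `|β|_2 = 2^{−j}` (`norm_padicAlgCl_two_pow_div_odd`), and `2^{−j} ≤ 2/r` when
  `q ≤ 2^l` (else `r² < 2q` outright).
So the Roth–Ridout quantity is `≤ (q/r²)·(2/r) = 2q/r³`; off the finite exceptional set it exceeds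
`H(β)^{−κ} = r^{−(2+δ')}`, whence `r^{1−δ'} < 2q`, i.e. `r² < (2q)^{2/(1−δ')} = (2q)^{2+δ}` for
`δ' = δ/(2+δ)`; on the exceptional set `r = den β` is bounded.  Hence
`squarePencil_depth_of_padicRoth`, and with T52's dictionary `squarePencil_abc_of_padicRoth`:
**abc holds on the square pencil, granting Ridout's theorem** — the pencil carries no difficulty
beyond (an effective form of) Roth–Ridout for `√2` and `2`-power denominators.

## Main statements

* `isAlgebraic_sqrt_two`, `squarePencil_archimedean`, `norm_padicAlgCl_two_pow_div_odd` — the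
  three inputs (algebraicity of the target, the archimedean and the `2`-adic local estimates).
* `squarePencil_depth_of_padicRoth` — `hRat ⟹ ∀ δ > 0, ∃ C > 0, 2^l + q = r², q odd ⟹ r² < C q^{2+δ}`.
* `squarePencil_abc_of_padicRoth` — `hRat ⟹` abc on the pencil (`q`, `r` squarefree, `l ≥ 1`).

## References

* [Ridout1958] D. Ridout, *The p-adic generalization of the Thue–Siegel–Roth theorem*,
  Mathematika 5 (1958) 40–48.
* [BombieriGubler2006] E. Bombieri, W. Gubler, *Heights in Diophantine Geometry*, CUP 2006,
  Thm. 6.2.3 (the form with `K = ℚ`, `S ∋ ∞` is the hypothesis `hRat` below, verbatim as in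
  `PadicRothIntegers.lean`).
-/

noncomputable section

namespace Summit.ABC.ABC.Theorems

open Real UniqueFactorizationMonoid Literature.NumberTheory.DiophantineApproximation
  Literature.NumberTheory.DiophantineGeometry

/-- `√2` is algebraic over `ℚ` (a root of `X² − 2`). [folklore] -/
theorem isAlgebraic_sqrt_two : IsAlgebraic ℚ (Real.sqrt 2) := by
  refine ⟨Polynomial.X ^ 2 - Polynomial.C 2, ?_, ?_⟩
  · intro h
    have := congrArg (Polynomial.eval 0) h
    norm_num at this
  · have h2 : Real.sqrt 2 ^ 2 = 2 := Real.sq_sqrt (by norm_num)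
    simp [h2]

/-- **Archimedean local estimate on the square pencil.**  If `2^{2j+1} + q = r²` then
`|2^j / r − 1/√2| ≤ q / r²`: indeed `(r − 2^j√2)(r + 2^j√2) = q`, so
`|2^j/r − 1/√2| = (r − 2^j√2)/(r√2) ≤ q/(r²√2)`. [this project] -/
theorem squarePencil_archimedean {j q r : ℕ} (he : 2 ^ (2 * j + 1) + q = r ^ 2) :
    |(2 : ℝ) ^ j / r - (Real.sqrt 2)⁻¹| ≤ (q : ℝ) / (r : ℝ) ^ 2 := by
  have hs0 : 0 < Real.sqrt 2 := Real.sqrt_pos.mpr (by norm_num)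
  have hs2 : Real.sqrt 2 ^ 2 = 2 := Real.sq_sqrt (by norm_num)
  have hs1 : 1 ≤ Real.sqrt 2 := by
    rw [show (1 : ℝ) = Real.sqrt 1 by simp]
    exact Real.sqrt_le_sqrt (by norm_num)
  have ht0 : (0 : ℝ) < 2 ^ j := by positivity
  have heR : (r : ℝ) ^ 2 = 2 * ((2 : ℝ) ^ j) ^ 2 + q := by
    have h1 : ((2 ^ (2 * j + 1) + q : ℕ) : ℝ) = ((r ^ 2 : ℕ) : ℝ) := by rw [he]
    push_cast at h1
    rw [← h1]; ring
  have hr0 : (0 : ℝ) < r := by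
    have h1 : (0 : ℝ) < (r : ℝ) ^ 2 := by rw [heR]; positivity
    rcases Nat.eq_zero_or_pos r with h | h
    · rw [h] at h1; norm_num at h1
    · exact_mod_cast h
  have hq0 : (0 : ℝ) ≤ q := Nat.cast_nonneg q
  -- `√2 · 2^j ≤ r`
  have hst : Real.sqrt 2 * 2 ^ j ≤ r := by
    have h1 : (Real.sqrt 2 * 2 ^ j) ^ 2 ≤ (r : ℝ) ^ 2 := by
      rw [mul_pow, hs2, heR]; linarith
    exact (pow_le_pow_iff_left₀ (by positivity) hr0.le two_ne_zero).mp h1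
  have hD0 : 0 ≤ (r : ℝ) - Real.sqrt 2 * 2 ^ j := by linarith
  -- `(r − √2 2^j)(r + √2 2^j) = q`
  have hD : ((r : ℝ) - Real.sqrt 2 * 2 ^ j) * ((r : ℝ) + Real.sqrt 2 * 2 ^ j) = q := by
    have h1 : ((r : ℝ) - Real.sqrt 2 * 2 ^ j) * ((r : ℝ) + Real.sqrt 2 * 2 ^ j) =
        (r : ℝ) ^ 2 - Real.sqrt 2 ^ 2 * ((2 : ℝ) ^ j) ^ 2 := by ring
    rw [h1, hs2, heR]; ring
  have hkey : |(2 : ℝ) ^ j / r - (Real.sqrt 2)⁻¹| =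
      ((r : ℝ) - Real.sqrt 2 * 2 ^ j) / (r * Real.sqrt 2) := by
    have h1 : (2 : ℝ) ^ j / r - (Real.sqrt 2)⁻¹ =
        -(((r : ℝ) - Real.sqrt 2 * 2 ^ j) / (r * Real.sqrt 2)) := by
      field_simp
      ring
    rw [h1, abs_neg, abs_of_nonneg (div_nonneg hD0 (by positivity))]
  rw [hkey, div_le_div_iff₀ (by positivity) (by positivity)]
  -- `(r − √2 2^j) · r ≤ q`
  have hDr : ((r : ℝ) - Real.sqrt 2 * 2 ^ j) * r ≤ q := by
    nlinarith [hD, mul_nonneg hD0 (mul_nonneg hs0.le ht0.le)]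
  nlinarith [mul_le_mul_of_nonneg_right hDr hr0.le,
    mul_nonneg (mul_nonneg hq0 hr0.le) (sub_nonneg.mpr hs1)]

/-- **`2`-adic local estimate.**  For `r` odd, `|2^j / r|_2 = 2^{−j}` in `\overline{ℚ_2}`.
[folklore] -/
theorem norm_padicAlgCl_two_pow_div_odd [Fact (Nat.Prime 2)] (j : ℕ) {r : ℕ} (hr : Odd r) :
    ‖((((2 ^ j : ℕ) : ℤ) / ((r : ℕ) : ℤ) : ℚ) : PadicAlgCl 2)‖ = ((2 : ℝ) ^ j)⁻¹ := by
  have hr0 : (r : ℤ) ≠ 0 := by exact_mod_cast hr.pos.ne'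
  have h2j : ((2 ^ j : ℕ) : ℤ) ≠ 0 := by positivity
  have hcast : ((((2 ^ j : ℕ) : ℤ) / ((r : ℕ) : ℤ) : ℚ) : PadicAlgCl 2) =
      (((2 ^ j : ℕ) : ℤ) : PadicAlgCl 2) / ((r : ℤ) : PadicAlgCl 2) := by
    push_cast
    rfl
  rw [hcast, norm_div, norm_intCast_padicAlgCl 2 h2j, norm_intCast_padicAlgCl 2 hr0]
  have hv1 : padicValInt 2 ((2 ^ j : ℕ) : ℤ) = j := by
    rw [padicValInt.of_nat, padicValNat.prime_pow]
  have hv2 : padicValInt 2 (r : ℤ) = 0 := by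
    rw [padicValInt.of_nat, padicValNat.eq_zero_of_not_dvd]
    exact hr.not_two_dvd_nat
  rw [hv1, hv2]
  simp [zpow_neg, zpow_natCast]

/-- **Depth on the square pencil from Ridout's theorem.**  Granting the `p`-adic Roth theorem for
rationals (`hRat` = [BombieriGubler2006, Thm. 6.2.3] with `K = ℚ`, `S ∋ ∞`, verbatim the hypothesis
of `padicRoth_int_of_rat`): for every `δ > 0` there is `C > 0` with `r² < C · q^{2+δ}` whenever
`2^l + q = r²`, `q` odd.  (Apply `hRat` with `S = {2}`, `α_∞ = 1/√2`, `α_2 = 0`, `κ = 2 + δ/(2+δ)`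
to `β = 2^j/r`, `l = 2j+1`; see the module docstring.) [cite: BombieriGubler2006, Thm. 6.2.3;
Ridout1958] -/
theorem squarePencil_depth_of_padicRoth
    (hRat : ∀ (S : Finset Nat.Primes) (α₀ : ℝ), IsAlgebraic ℚ α₀ →
      ∀ (α : ∀ p : Nat.Primes, @PadicAlgCl (p : ℕ) ⟨p.2⟩), (∀ p ∈ S, IsAlgebraic ℚ (α p)) →
      ∀ κ : ℝ, 2 < κ →
        {β : ℚ | min 1 |(β : ℝ) - α₀| *
            (∏ p ∈ S, min (1 : ℝ) ‖(β : @PadicAlgCl (p : ℕ) ⟨p.2⟩) - α p‖) ≤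
          (max (|(β.num : ℝ)|) (β.den : ℝ)) ^ (-κ)}.Finite) :
    ∀ δ : ℝ, 0 < δ → ∃ C : ℝ, 0 < C ∧ ∀ l q r : ℕ, Odd q → 2 ^ l + q = r ^ 2 →
      (r : ℝ) ^ 2 < C * (q : ℝ) ^ (2 + δ) := by
  classical
  have _inst (p : Nat.Primes) : Fact (p : ℕ).Prime := ⟨p.2⟩
  intro δ hδ
  -- exponents: `κ = 2 + δ'`, `δ' = δ/(2+δ)`, so that `1/(1 − δ') = (2+δ)/2`
  set δ' : ℝ := δ / (2 + δ) with hδ'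
  have hδ'0 : 0 < δ' := by positivity
  have h1δ' : 1 - δ' = 2 / (2 + δ) := by
    rw [hδ']; field_simp; ring
  have h1δ'0 : 0 < 1 - δ' := by rw [h1δ']; positivity
  have hκ : (2 : ℝ) < 2 + δ' := by linarith
  -- Roth–Ridout for `S = {2}`, `α_∞ = 1/√2`, `α_2 = 0`
  have hB := hRat ({⟨2, Nat.prime_two⟩} : Finset Nat.Primes) (Real.sqrt 2)⁻¹
    isAlgebraic_sqrt_two.inv (fun _ => 0) (fun _ _ => isAlgebraic_zero) (2 + δ') hκ
  -- the constant: generic part `2^{2+δ} + 2`, exceptional part `M = Σ den²`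
  set M : ℝ := ∑ β ∈ hB.toFinset, ((β.den : ℕ) : ℝ) ^ 2 with hM
  have hM0 : 0 ≤ M := Finset.sum_nonneg fun β _ => sq_nonneg _
  have h40 : (0 : ℝ) < (2 : ℝ) ^ (2 + δ) := by positivity
  refine ⟨2 ^ (2 + δ) + 2 + M + 1, by positivity, ?_⟩
  intro l q r hq he
  -- generalities on `q`, `r`
  have hq1R : (1 : ℝ) ≤ q := by exact_mod_cast hq.pos
  have hq0R : (0 : ℝ) < q := by linarith
  have hqpow0 : (0 : ℝ) < (q : ℝ) ^ (2 + δ) := Real.rpow_pos_of_pos hq0R _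
  have hqpow1 : (1 : ℝ) ≤ (q : ℝ) ^ (2 + δ) := Real.one_le_rpow hq1R (by linarith)
  have hqpowq : (q : ℝ) ≤ (q : ℝ) ^ (2 + δ) := Real.self_le_rpow_of_one_le hq1R (by linarith)
  have hqpow2 : (q : ℝ) ^ 2 ≤ (q : ℝ) ^ (2 + δ) := by
    rw [← Real.rpow_natCast]
    exact Real.rpow_le_rpow_of_exponent_le hq1R (by push_cast; linarith)
  have hr0 : 0 < r := by
    rcases Nat.eq_zero_or_pos r with h | h
    · exfalso
      rw [h] at he
      have : 0 < 2 ^ l := Nat.pow_pos two_pos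
      simp at he
    · exact h
  have hr0R : (0 : ℝ) < r := by exact_mod_cast hr0
  -- how every case ends
  have hCq : ∀ {A : ℝ}, A ≤ 2 ^ (2 + δ) + 2 + M → (r : ℝ) ^ 2 ≤ A * (q : ℝ) ^ (2 + δ) →
      (r : ℝ) ^ 2 < (2 ^ (2 + δ) + 2 + M + 1) * (q : ℝ) ^ (2 + δ) := by
    intro A hA h
    calc (r : ℝ) ^ 2 ≤ A * (q : ℝ) ^ (2 + δ) := h
      _ < (2 ^ (2 + δ) + 2 + M + 1) * (q : ℝ) ^ (2 + δ) := by
          apply mul_lt_mul_of_pos_right _ hqpow0; linarith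
  rcases Nat.even_or_odd l with ⟨j, hj⟩ | ⟨j, hj⟩
  · -- even `l = j + j`: `(r − 2^j)(r + 2^j) = q`, so `r ≤ q` and `r² ≤ q²`
    have heZ : (2 : ℤ) ^ j * 2 ^ j + q = r * r := by
      have h1 : ((2 ^ l + q : ℕ) : ℤ) = ((r ^ 2 : ℕ) : ℤ) := by rw [he]
      push_cast at h1
      rw [hj, pow_add, sq] at h1
      exact h1
    have h2j0 : (0 : ℤ) ≤ 2 ^ j := by positivity
    have hq1Z : (1 : ℤ) ≤ q := by exact_mod_cast hq.pos
    have htr : (2 : ℤ) ^ j < r := by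
      by_contra hle
      rw [not_lt] at hle
      have : (r : ℤ) * r ≤ 2 ^ j * 2 ^ j := mul_le_mul hle hle (by positivity) h2j0
      linarith
    have h1 : (1 : ℤ) ≤ r - 2 ^ j := by linarith
    have hrt : (0 : ℤ) ≤ r + 2 ^ j := by positivity
    have hqr : (r : ℤ) ≤ q := by
      nlinarith [mul_le_mul_of_nonneg_right h1 hrt, heZ]
    have hqrR : (r : ℝ) ≤ q := by exact_mod_cast hqr
    have : (r : ℝ) ^ 2 ≤ 1 * (q : ℝ) ^ (2 + δ) := by
      rw [one_mul]; exact (pow_le_pow_left₀ hr0R.le hqrR 2).trans hqpow2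
    exact hCq (by linarith) this
  · -- odd `l = 2 j + 1`
    have hl1 : 1 ≤ l := by omega
    have hrodd : Odd r := squarePencil_odd_r hl1 hq he
    have he' : 2 * (2 ^ j) ^ 2 + q = r ^ 2 := by rw [← he, hj]; ring
    have he1 : 2 ^ (2 * j + 1) + q = r ^ 2 := by rw [← hj]; exact he
    have heR : (r : ℝ) ^ 2 = 2 * ((2 : ℝ) ^ j) ^ 2 + q := by exact_mod_cast he'.symm
    have h2j1 : 1 ≤ 2 ^ j := Nat.one_le_two_pow
    have htr : 2 ^ j < r := by
      have h1 : (2 ^ j) ^ 2 < r ^ 2 := by rw [← he']; nlinarith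
      exact (Nat.pow_lt_pow_iff_left two_ne_zero).mp h1
    by_cases hbig : 2 * (2 ^ j) ^ 2 < q
    · -- `q > 2^l`: `r² < 2 q`
      have h1 : r ^ 2 < 2 * q := by omega
      have h1R : (r : ℝ) ^ 2 < 2 * q := by exact_mod_cast h1
      have : (r : ℝ) ^ 2 ≤ 2 * (q : ℝ) ^ (2 + δ) := by nlinarith
      exact hCq (by linarith) this
    · -- `q ≤ 2^l`: then `r ≤ 2 · 2^j`, i.e. `2^{-j} ≤ 2 / r`
      have hsmall : q ≤ 2 * (2 ^ j) ^ 2 := not_lt.mp hbig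
      have hr2j : r ≤ 2 * 2 ^ j := by
        have h1 : r ^ 2 ≤ (2 * 2 ^ j) ^ 2 := by rw [← he']; nlinarith
        exact (Nat.pow_le_pow_iff_left two_ne_zero).mp h1
      have hr2jR : (r : ℝ) ≤ 2 * 2 ^ j := by exact_mod_cast hr2j
      have hinv : ((2 : ℝ) ^ j)⁻¹ ≤ 2 / r := by
        have h1 : (r : ℝ) / 2 ≤ 2 ^ j := by linarith
        calc ((2 : ℝ) ^ j)⁻¹ ≤ ((r : ℝ) / 2)⁻¹ := inv_anti₀ (by positivity) h1
          _ = 2 / r := by rw [inv_div]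
      -- the rational point `β = 2^j / r` (lowest terms) and its height `r`
      have hcop : Nat.Coprime (2 ^ j) r := (Nat.coprime_two_left.mpr hrodd).pow_left j
      have hb0 : (0 : ℤ) < ((r : ℕ) : ℤ) := by exact_mod_cast hr0
      have hcop' : Nat.Coprime ((2 ^ j : ℕ) : ℤ).natAbs ((r : ℕ) : ℤ).natAbs := by
        simpa only [Int.natAbs_natCast] using hcop
      set β : ℚ := (((2 ^ j : ℕ) : ℤ) : ℚ) / (((r : ℕ) : ℤ) : ℚ) with hβ
      have hnum : β.num = ((2 ^ j : ℕ) : ℤ) := Rat.num_div_eq_of_coprime hb0 hcop'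
      have hden : (β.den : ℤ) = ((r : ℕ) : ℤ) := Rat.den_div_eq_of_coprime hb0 hcop'
      have hdenN : β.den = r := by exact_mod_cast hden
      have hH : max (|(β.num : ℝ)|) (β.den : ℝ) = r := by
        rw [hnum, hdenN]
        push_cast
        rw [abs_of_nonneg (by positivity)]
        exact max_eq_right (by exact_mod_cast htr.le)
      have hβR : ((β : ℚ) : ℝ) = (2 : ℝ) ^ j / r := by
        rw [hβ]; push_cast; ring
      -- local estimates
      have harch : min 1 |((β : ℚ) : ℝ) - (Real.sqrt 2)⁻¹| ≤ (q : ℝ) / (r : ℝ) ^ 2 := by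
        rw [hβR]; exact (min_le_right _ _).trans (squarePencil_archimedean he1)
      have hβ2 : ‖(β : PadicAlgCl 2) - 0‖ = ((2 : ℝ) ^ j)⁻¹ := by
        rw [sub_zero, hβ]; exact norm_padicAlgCl_two_pow_div_odd j hrodd
      have hup : min 1 |((β : ℚ) : ℝ) - (Real.sqrt 2)⁻¹| *
          (∏ p ∈ ({⟨2, Nat.prime_two⟩} : Finset Nat.Primes),
            min (1 : ℝ) ‖(β : PadicAlgCl (p : ℕ)) - (0 : PadicAlgCl (p : ℕ))‖) ≤
          (q : ℝ) / (r : ℝ) ^ 2 * ((2 : ℝ) ^ j)⁻¹ := by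
        rw [Finset.prod_singleton]
        have h2 : min (1 : ℝ) ‖(β : PadicAlgCl ((⟨2, Nat.prime_two⟩ : Nat.Primes) : ℕ)) -
            (0 : PadicAlgCl ((⟨2, Nat.prime_two⟩ : Nat.Primes) : ℕ))‖ ≤ ((2 : ℝ) ^ j)⁻¹ :=
          (min_le_right _ _).trans hβ2.le
        exact mul_le_mul harch h2 (le_min zero_le_one (norm_nonneg _)) (by positivity)
      by_cases hmem : β ∈ hB.toFinset
      · -- exceptional point of Roth–Ridout: `r = den β` is bounded
        have h1 : ((β.den : ℕ) : ℝ) ^ 2 ≤ M :=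
          Finset.single_le_sum (f := fun γ : ℚ => ((γ.den : ℕ) : ℝ) ^ 2)
            (fun _ _ => sq_nonneg _) hmem
        rw [hdenN] at h1
        have : (r : ℝ) ^ 2 ≤ M * (q : ℝ) ^ (2 + δ) :=
          h1.trans (le_mul_of_one_le_right hM0 hqpow1)
        exact hCq (by linarith) this
      · -- generic point: `r^{-(2+δ')} < 2q / r³`
        rw [Set.Finite.mem_toFinset, Set.mem_setOf_eq, not_le, hH] at hmem
        have hlow : (r : ℝ) ^ (-(2 + δ')) < 2 * q / (r : ℝ) ^ 3 := by
          calc (r : ℝ) ^ (-(2 + δ')) < (q : ℝ) / (r : ℝ) ^ 2 * ((2 : ℝ) ^ j)⁻¹ :=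
                lt_of_lt_of_le hmem hup
            _ ≤ (q : ℝ) / (r : ℝ) ^ 2 * (2 / r) :=
                mul_le_mul_of_nonneg_left hinv (by positivity)
            _ = 2 * q / (r : ℝ) ^ 3 := by
                field_simp
        -- `r^{1-δ'} < 2 q`
        have hρ : (r : ℝ) ^ (1 - δ') < 2 * q := by
          have h1 : (r : ℝ) ^ (-(2 + δ')) * (r : ℝ) ^ 3 < 2 * q :=
            (lt_div_iff₀ (by positivity)).mp hlow
          have h2 : (r : ℝ) ^ (-(2 + δ')) * (r : ℝ) ^ 3 = (r : ℝ) ^ (1 - δ') := by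
            rw [← Real.rpow_natCast (r : ℝ) 3, ← Real.rpow_add hr0R]
            congr 1
            push_cast
            ring
          rwa [h2] at h1
        -- `r < (2q)^{(2+δ)/2}`, `r² < (2q)^{2+δ} = 2^{2+δ} q^{2+δ}`
        have hr_lt : (r : ℝ) < (2 * q) ^ ((2 + δ) / 2) := by
          have h1 : (r : ℝ) = ((r : ℝ) ^ (1 - δ')) ^ (1 / (1 - δ')) := by
            rw [← Real.rpow_mul hr0R.le, mul_one_div_cancel h1δ'0.ne', Real.rpow_one]
          have h2 : 1 / (1 - δ') = (2 + δ) / 2 := by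
            rw [h1δ']; field_simp
          rw [h1, ← h2]
          exact Real.rpow_lt_rpow (Real.rpow_nonneg hr0R.le _) hρ (by positivity)
        have hsq : (r : ℝ) ^ 2 < (2 : ℝ) ^ (2 + δ) * (q : ℝ) ^ (2 + δ) := by
          have h1 : ((2 * q : ℝ) ^ ((2 + δ) / 2)) ^ 2 = (2 : ℝ) ^ (2 + δ) * (q : ℝ) ^ (2 + δ) := by
            rw [← Real.rpow_natCast ((2 * q : ℝ) ^ ((2 + δ) / 2)) 2,
              ← Real.rpow_mul (by positivity), Real.mul_rpow (by norm_num) hq0R.le]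
            congr 1 <;> [skip; skip] <;> push_cast <;> ring_nf
          rw [← h1]
          exact pow_lt_pow_left₀ hr_lt hr0R.le two_ne_zero
        exact hCq (by linarith) hsq.le

/-- **abc on the square pencil, granting Ridout's theorem.**  With `hRat` as above: for every
`ε > 0` there is `C > 0` such that every `2^l + q = r²` with `l ≥ 1`, `q` odd and `q`, `r`
squarefree satisfies `c = r² < C · rad(2^l · q · r²)^{1+ε}`.  (T52's dictionary
`squarePencil_abc_of_depth` applied to `squarePencil_depth_of_padicRoth`.)
[cite: BombieriGubler2006, Thm. 6.2.3; Ridout1958] -/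
theorem squarePencil_abc_of_padicRoth
    (hRat : ∀ (S : Finset Nat.Primes) (α₀ : ℝ), IsAlgebraic ℚ α₀ →
      ∀ (α : ∀ p : Nat.Primes, @PadicAlgCl (p : ℕ) ⟨p.2⟩), (∀ p ∈ S, IsAlgebraic ℚ (α p)) →
      ∀ κ : ℝ, 2 < κ →
        {β : ℚ | min 1 |(β : ℝ) - α₀| *
            (∏ p ∈ S, min (1 : ℝ) ‖(β : @PadicAlgCl (p : ℕ) ⟨p.2⟩) - α p‖) ≤
          (max (|(β.num : ℝ)|) (β.den : ℝ)) ^ (-κ)}.Finite) :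
    ∀ ε : ℝ, 0 < ε → ∃ C : ℝ, 0 < C ∧ ∀ l q r : ℕ, 1 ≤ l → Odd q → Squarefree q → Squarefree r →
      2 ^ l + q = r ^ 2 →
        (r : ℝ) ^ 2 < C * ((rad (2 ^ l) q (r ^ 2) : ℕ) : ℝ) ^ (1 + ε) :=
  squarePencil_abc_of_depth (squarePencil_depth_of_padicRoth hRat)

end Summit.ABC.ABC.Theorems

end
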